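import Summits.HodgeConjecture.HodgeConjecture.Theorems.F0P3RelParityOfT5Parity            -- ★ part A (this pen): the parity algebra of (14.6.3)'s coefficients, over ★ `F0P3APacketMembersOfT5` (T5 V8 chain)
import Summits.HodgeConjecture.HodgeConjecture.Theorems.F0P3SLayerFoldShapes               -- ★ `exists_cohToken_of_isHolOrAntihol_cpt` (the `(𝔤,K)`-token of a cotangent `P`)
import Summits.HodgeConjecture.HodgeConjecture.Theorems.F0P3CompactTrivOfRecord            -- ★ `cmCompactFactor_rightRegular_eq_self_of_isHolOrAntihol` (`KcTrivial`)
import Summits.HodgeConjecture.HodgeConjecture.Theorems.F0P3AntiholCohUnitaryToken         -- ★ `exists_cohUnitaryToken_of_isCot_cpt` (a coh-unitary token)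
import Summits.HodgeConjecture.HodgeConjecture.Theorems.F0P3bHolAntiholInequivalent        -- ★ `upqTypeClasses_ne_bot_of_gkEquiv` (degree-one classes transport along `GKEquiv`)
import Summits.HodgeConjecture.HodgeConjecture.Theorems.F0P3bArchDegOneClass               -- ★ `ofModule_eq_archDegOneClass` (canonicity `[J^δ]`)
import Summits.HodgeConjecture.HodgeConjecture.Theorems.F0P3XiRigid                        -- ★ `memXiFamily_rigid_cm` (one `P` lies in ONE ξ-family)
import Summits.HodgeConjecture.HodgeConjecture.Theorems.F0P3AutomorphicFlathAdmissibleOfCot -- ★ `exists_irreducible_admissible_hasFinComponent_of_isCot`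
import Summits.HodgeConjecture.HodgeConjecture.Theorems.F0P3FinRepConstituentsExist        -- ★ `exists_comap_isConstituentOf_finRepSmooth_comp_cm`
import Summits.HodgeConjecture.HodgeConjecture.Theorems.F0P2oSupercuspidalNeConstituent    -- ★ NE `stubSupercuspidalNeConstituent_holds` (`πⁿ` is not supercuspidal, non-split `v`)
import Literature.NumberTheory.Rogawski1990.CMLocalAPacketMembers                          -- ★ `cmSplitPacket_πs` (`rfl`: no `πˢ` at a split place)
import HarnessLib

/-!
# `F0P3RelParityOfT5` — «REL♯ ⟸ T5 at 𝔎₀»: the RELATIVE PARITY of the supercuspidal labels of two cotangent members of ONE ξ-family, EXPORTED from the T5 engine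
# (kit-generic, theorems only, 0 `sorry`) — F2 part B of the road (desk F0P2-plan (g12) CENSUS `F0/P2/CENSUS-RELSHARP-T5.F0P2-plan-g12.md`, LEAD F0P3a-plan (g10) T9-13 (2))

Cell `pub/hodgecm-mathlib`, F0∕P2 ∕ P3, crux H413 (`stmt-HodgeConjecture-24833`); books row #162 REL♯ «(C4)» = `Cruxes/H413/Lines/F0_P2E3RelEngine.lean :: StubRelSharpParity`.
Pen F0P2-p02 (g9); census `F0/P2/p02/g9/CENSUS-F2-RelParityOfT5.F0P2p02g9.md`.  HONEST LABEL: HC_CM is proved only modulo the printed citations until rung 0 closes; this file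
discharges NOTHING by itself — it is kit-generic over T5's pins + laws exactly like ★ `aPacketMembersGuarded_of_T5` (#75's global half), and becomes REL♯ for the actual `U(H)` only
at the closer's kit family of record `𝔎₀`, where its open content is the closer's own stub set; the book-closing token (#162 ↦ CLOSED-DERIVED) is the P3 desk's one-line junction
`relSharp₀ := relSharpGuarded_of_T5 𝔎₀ hpin₀ hlaws₀ hξside₀` (F3 of the desk's plan).

THE MATHEMATICS [Rogawski1990, §14.6 Thm. 14.6.4 and its proof, p. 238 l. −4 – p. 239 l. 4; Prop. 13.1.3 (d); Prop. 15.2.1].  For ONE cotangent `Kc`-trivial `P` the T5 reading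
(★ `mult_eq_one_of_laws_grouped`) gives `m(P) = 1 = E_ξ(P_ι, (P_v)_{v ∈ S})` for every level `S` above a threshold, with all coordinates MEMBERS of the A-packets; by part A
this pins the sign `ε_ι(P) ∏_S ε_v(P) = c(ξ)`.  For TWO such `P`, `P′` in ONE `ξ` (rigidity ★ `memXiFamily_rigid_cm` identifies the engine's `ξ_P`, `ξ_P′` with the given `ξ`)
read at a COMMON `S`, the constants `N` and `c(ξ)` CANCEL; the archimedean coefficients agree because the archimedean class of a cotangent `P` is CANONICAL — `[J^δ]` with
`δ = sgnInf ξ` (law `tokenInf` at two tokens, ★ canonicity `ofModule_eq_archDegOneClass`, law `archPacketCoh`) — so the finite coordinate classes of `P`, `P′` differ at an EVEN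
number of `v ∈ S` and agree (`= πⁿ`) off `S`.  Finally «the supercuspidal LABELS differ at `v`» ⟺ «the classes differ at `v`»: the label is read off the class (law
`localIsotypyFin` + a constituent exists), and two distinct members of one packet of a ξ-local family are `{πⁿ, πˢ}` at a NON-SPLIT `v` (at a split `v` the packet is a
singleton, ★ `cmSplitPacket_πs`), where `πˢ` is supercuspidal (★ D6 clause) and `πⁿ` is not (★ NE `stubSupercuspidalNeConstituent_holds`).

* §1 **`core_of_laws`** — one kit, one cotangent `P`: `∃ ξ S₁, ∀ S ⊇ S₁, E_ξ(coordS S (cl P)) = 1 ∧ c(ξ) = ±1 ∧ memberships ∧ (off `S`: `πⁿ`) ∧ family ∧ `MemXiFamily P ξ`;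
* §3 **`clInf_eq_archDegOneClass_of_laws`** — `clInf (cl P) = archDegOneClass δ` and `δ = sgnInf ξ` on the packet (E4 of the census);
* §4 **`exists_isSupercuspidal_constituent_iff_of_laws`** (the label is the class), **`not_isSupercuspidal_iff_of_ne_of_isXiLocalFamily`** (distinct members ⇒ different labels);
* §5 **`even_ncard_setOf_not_iff`** (bookkeeping), **`relSharp_of_laws`** — two kits on two measures with a common ξ-side `hξside` (the E0 seam, a HYPOTHESIS);
* §6 HEAD **`relSharpGuarded_of_T5 (𝔎) (hpin) (hlaws) (hξside)`** : the text of `StubRelSharpParity` with the Lines-local `CuspLabel` UNFOLDED (Theorems cannot import Lines; F1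
  `RelSharpParity₀` of F0P2-p01 folds by delta).

DEF∕PROOF discipline: theorems only; no `def`, no instance, no notation, no new kit law (rider (r2)), no `sorry`; `--supports stmt-HodgeConjecture-24833 --as helper`.
Two scoped heartbeat budgets (`relSharp_of_laws` 5×, head 2×): the REL♯ binder text (`IsHolCotangentAt` ∕ `smoothPart`) elaborates slowly — precedent ★ `F0P2rCuspDictHolds`.
-/

set_option autoImplicit false
set_option linter.dupNamespace false


noncomputable section

open NumberField IsDedekindDomain MeasureTheory
open scoped Matrix ComplexOrder BigOperators Classical

namespace Summit.HodgeConjecture.HodgeConjecture.Cruxes.H413.F0P3RelParityOfT5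

open Literature.NumberTheory.Rogawski1990 Literature.NumberTheory.GaloisRepresentations
open Literature.NumberTheory.Automorphic Literature.NumberTheory.Automorphic.UnitaryGroup
open Literature.NumberTheory.Automorphic.UnitaryGroup.CotangentForms
open Literature.RepresentationTheory.BorelWallach2000
open Literature.RepresentationTheory.KonnoKonno2007
open Summit.HodgeConjecture.HodgeConjecture.Cruxes.H413.F0P3InnerFormClassificationV6 (Gp Places LocS EqOff IsCot KcTrivial HasToken one_le_multiplicity)
open Summit.HodgeConjecture.HodgeConjecture.Cruxes.H413.F0P3InnerFormClassificationV6.ClassificationKit (coordS memberCoeff Adm)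
open Summit.HodgeConjecture.HodgeConjecture.Cruxes.H413.F0P3InnerFormClassificationV8

/-! ## §1 ONE KIT, ONE COTANGENT `P`: routing, the coefficient reading `E_ξ = 1` on a COMMON level `S`, memberships, the family -/

section Core

variable {L : Type} [Field L] [NumberField L] [IsCMField L] {H : Matrix (Fin 3) (Fin 3) L} {ι : L →+* ℂ} {T : GL (Fin 3) ℂ}
  {hT : (T : Matrix (Fin 3) (Fin 3) ℂ)ᴴ * H.map ι * (T : Matrix (Fin 3) (Fin 3) ℂ) = Literature.Geometry.ComplexHyperbolic.BallModel.J}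
  {μ : Measure (Gp L H).automorphicQuotient} [(Gp L H).IsAutomorphicMeasure μ]

/-- **THE CORE READING FOR ONE COTANGENT `P`** (pattern ★ `aPacketMembers_of_T5`, with the expansion value EXPORTED and the level `S` left FREE above a
threshold `S₁`, so that two `P`'s can be read at a COMMON `S`): routing gives `ξ` with the e.v.p. of `Π(ξ)` off `S₁ ⊇ S₀ ∪ ram ξ ∪ ramCls (cl P)`; for every
`S ⊇ S₁` the coefficient reading (★ `mult_eq_one_of_laws_grouped` over the laws, as in ★ `aPacketMembers_of_laws`) gives `E_ξ(coordS S (cl P)) = 1`, hence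
all coordinates are MEMBERS (★ `coords_mem_of_expansion_ne_zero`), off `S` the class is `πⁿ` (★ `unramMember_of_pins`), `c(ξ) = ±1` (law `localExpansion`),
and `P` lies in the ξ-local family `packFin ξ` (laws `localIsotypyFin`, `xiFamilyFin`). [cite: Rogawski1990, §14.6 Thm. 14.6.4 pp. 238–239, 244; §13.7 p. 206] -/
theorem core_of_laws (𝔠 : ClassificationKit L H ι T hT μ) (hpin : 𝔠.IsPinned) {μω : HeckeCharacter L} {hμu : μω.IsUnitary}
    {S₀ : Finset (Places L)} (hl : 𝔠.Laws μω hμu S₀)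
    (hdef : ∀ τ' : L →+* ℂ, InfinitePlace.mk τ' ≠ InfinitePlace.mk ι → (H.map τ').PosDef) (h2 : 2 ≤ Module.finrank ℚ ↥(maximalRealSubfield L))
    (P : DiscreteAutomorphicRep (Gp L H) μ) (hP : IsCot L H ι T hT μ P) (hKc : KcTrivial L H ι T hT μ P) :
    ∃ (ξ : OneDimAutRepH L) (S₁ : Finset (Places L)), ∀ S : Finset (Places L), S₁ ⊆ S →
      𝔠.expansion ξ S (𝔠.coordS S (𝔠.cl P)) = 1 ∧ (𝔠.sgnG ξ = 1 ∨ 𝔠.sgnG ξ = -1) ∧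
      𝔠.clInf (𝔠.cl P) ∈ (𝔠.packInf ξ).members ∧ (∀ v : Places L, 𝔠.clFin (𝔠.cl P) v ∈ (𝔠.packFin ξ v).members) ∧
      (∀ v : Places L, v ∉ S → 𝔠.clFin (𝔠.cl P) v = (𝔠.packFin ξ v).πn) ∧
      ξ.IsXiLocalFamily (transpose_map_cmConjRingHom_eq_of_frame L ι H T hT) (isUnit_det_of_frame L ι H T hT) μω hμu (𝔠.packFin ξ) ∧
      MemXiFamily P (transpose_map_cmConjRingHom_eq_of_frame L ι H T hT) (isUnit_det_of_frame L ι H T hT) μω hμu ξ := by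
  -- the `(𝔤,K)`-token of the cotangent `P` (★), then ROUTING (law (L3′))
  obtain ⟨M, _, _, σK, σ𝔤, hM, δ, hδ, hirr, htok, hne'⟩ := F0P3SLayerFoldShapes.exists_cohToken_of_isHolOrAntihol_cpt L ι H T hT μ hdef h2 P hP
  obtain ⟨ξ, S₁, hξ⟩ := hl.routing P hP hKc M σK σ𝔤 hM hirr htok δ hδ hne'
  -- pin (x): finiteness of the exact ramification set
  have hfinR : (𝔠.ramCls (𝔠.cl P)).Finite := hpin.2.2.2.2.2.2.2.2.2 P hP hKc
  refine ⟨ξ, S₁ ∪ 𝔠.ram ξ ∪ hfinR.toFinset ∪ S₀, fun S hS => ?_⟩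
  have hS₀ : S₀ ⊆ S := Finset.subset_union_right.trans hS
  have hS₁ : S₁ ⊆ S := ((Finset.subset_union_left.trans Finset.subset_union_left).trans Finset.subset_union_left).trans hS
  have hram : 𝔠.ram ξ ⊆ S := ((Finset.subset_union_right.trans Finset.subset_union_left).trans Finset.subset_union_left).trans hS
  have hR : hfinR.toFinset ⊆ S := (Finset.subset_union_right.trans Finset.subset_union_left).trans hS
  have hr : Adm 𝔠 S (𝔠.cl P) :=
    ⟨fun v hv => Finset.mem_coe.2 (hR (hfinR.mem_toFinset.2 hv)), hpin.2.2.2.2.2.2.2.2.1 P hKc⟩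
  have hξS : EqOff L H S (𝔠.evp (𝔠.cl P)) (𝔠.tXi ξ) := EqOff.mono L H hS₁ hξ
  -- pin (i): `1 ≤ mult (cl P)`
  have hm1 : (1 : ℕ∞) ≤ ((𝔠.mult (𝔠.cl P) : ℕ) : ℕ∞) := by rw [hpin.1 P]; exact one_le_multiplicity L H μ P
  have hm1' : 1 ≤ 𝔠.mult (𝔠.cl P) := by exact_mod_cast hm1
  -- THE COEFFICIENT READING by fibre grouping, over the laws (the integrator's own mathematics, ★)
  obtain ⟨-, hE⟩ := 𝔠.mult_eq_one_of_laws_grouped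
    (perClassIdentity_of_laws _ hl.traceIdentity hl.spectralSideGp hl.factorisation hl.matchingS
      (separation_of_laws _ (hatInjective_of_pins _ hpin hl.evpConvention) hl.hatBounded hl.unrStarAlgebra) hl.unrStarAlgebra)
    hl.transferS hl.linIndepS hl.unitaryCoord hl.unitaryPacket hl.aPacketSpectral hl.localExpansion ξ S hS₀ hram (𝔠.cl P) hξS hr hm1'
  have hc : 𝔠.sgnG ξ = 1 ∨ 𝔠.sgnG ξ = -1 := (hl.localExpansion ξ S hS₀ hram).1
  -- memberships inside `S` (★ `coords_mem_of_expansion_ne_zero`)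
  obtain ⟨hIm, -, hFm⟩ := 𝔠.coords_mem_of_expansion_ne_zero ξ S (𝔠.coordS S (𝔠.cl P)) (by rw [hE]; exact one_ne_zero)
  -- outside `S`: the unramified member (★ `unramMember_of_pins`)
  have hoff : ∀ v : Places L, v ∉ S → 𝔠.clFin (𝔠.cl P) v = (𝔠.packFin ξ v).πn := by
    intro v hv
    have hv1 : v ∉ 𝔠.ram ξ := fun h => hv (hram h)
    have hv2 : v ∉ 𝔠.ramCls (𝔠.cl P) := fun h => hv (Finset.mem_coe.1 (hr.1 h))
    exact 𝔠.unramMember_of_pins hpin hl.xiUnram ξ (𝔠.cl P) v hv1 hv2 (hξS v hv)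
  have hall : ∀ v : Places L, 𝔠.clFin (𝔠.cl P) v ∈ (𝔠.packFin ξ v).members := by
    intro v
    by_cases hv : v ∈ S
    · exact hFm ⟨v, hv⟩
    · rw [hoff v hv]; exact LocalAPacket.πn_mem_members _
  refine ⟨hE, hc, hIm, hall, hoff, hl.xiFamilyFin ξ, ⟨𝔠.packFin ξ, hl.xiFamilyFin ξ, fun v c' hc' => ?_⟩⟩
  rw [hl.localIsotypyFin P hP hKc v c' hc']
  exact hall v

/-! ## §3 THE ARCHIMEDEAN COORDINATE IS CANONICAL: `clInf (cl P) = [J^δ]`, and `δ = sgnInf ξ` on the packet -/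

/-- **`clInf (cl P) = archDegOneClass δ`** for a cotangent `P` with a type-`δ` token (law `tokenInf` at that token AND at a coh-unitary token ★
`exists_cohUnitaryToken_of_isCot_cpt`; the two classes agree, so the modules are `(𝔤,K)`-equivalent (★ `ofModule_eq_ofModule_iff`), the type-`δ` class
transports (★ `upqTypeClasses_ne_bot_of_gkEquiv`), and CANONICITY ★ `ofModule_eq_archDegOneClass` names the class); on the packet `Π(ξ_ι)` the law
`archPacketCoh` then pins `δ = sgnInf ξ`. [cite: Rogawski1990, Prop. 15.2.1 (b) p. 244; §12.3 p. 178] [cite: BorelWallach2000, VI Thm. 4.11] -/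
theorem clInf_eq_archDegOneClass_of_laws (𝔠 : ClassificationKit L H ι T hT μ) {μω : HeckeCharacter L} {hμu : μω.IsUnitary}
    {S₀ : Finset (Places L)} (hl : 𝔠.Laws μω hμu S₀)
    (hdef : ∀ τ' : L →+* ℂ, InfinitePlace.mk τ' ≠ InfinitePlace.mk ι → (H.map τ').PosDef) (h2 : 2 ≤ Module.finrank ℚ ↥(maximalRealSubfield L))
    (P : DiscreteAutomorphicRep (Gp L H) μ) (hP : IsCot L H ι T hT μ P) :
    ∃ (δ : ℤ) (hδ : δ = 1 ∨ δ = -1), 𝔠.clInf (𝔠.cl P) = F0P3bArchDegOneClass.archDegOneClass δ hδ ∧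
      ∀ ξ : OneDimAutRepH L, 𝔠.clInf (𝔠.cl P) ∈ (𝔠.packInf ξ).members → δ = 𝔠.sgnInf ξ := by
  -- a token with a type-`δ` class (★) and a coh-unitary token (★) of the same `P`
  obtain ⟨M, _, _, σK, σ𝔤, hM, δ, hδ, hirr, htok, hne'⟩ := F0P3SLayerFoldShapes.exists_cohToken_of_isHolOrAntihol_cpt L ι H T hT μ hdef h2 P hP
  obtain ⟨r, htok₂, hr⟩ := F0P3AntiholCohUnitaryToken.exists_cohUnitaryToken_of_isCot_cpt L H ι T hT μ hdef h2 P hP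
  have h₁ : 𝔠.clInf (𝔠.cl P) = GKIrrClass.ofModule M σK σ𝔤 hM hirr := hl.tokenInf P hP M σK σ𝔤 hM hirr htok
  have h₂ : 𝔠.clInf (𝔠.cl P) = GKIrrClass.ofModule r.V r.ρK r.ρ𝔤 hr.gk hr.irred := hl.tokenInf P hP r.V r.ρK r.ρ𝔤 hr.gk hr.irred htok₂
  obtain ⟨e⟩ : AreGKEquivalent σK σ𝔤 r.ρK r.ρ𝔤 := (GKIrrClass.ofModule_eq_ofModule_iff _ _ _ _ _ _ _ _ _ _).1 (h₁.symm.trans h₂)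
  have hne'' : upqTypeClasses r.ρK r.ρ𝔤 hr.gk.ad_compat 1 δ ≠ ⊥ := F0P3bArchDegOnePackage.upqTypeClasses_ne_bot_of_gkEquiv hM hr.gk e hne'
  refine ⟨δ, hδ, h₂.trans (F0P3bArchDegOneClass.ofModule_eq_archDegOneClass r.ρK r.ρ𝔤 hr δ hδ hne''), fun ξ hmem => ?_⟩
  rw [h₂] at hmem
  exact hl.archPacketCoh ξ r.V r.ρK r.ρ𝔤 hr.gk hr.irred hmem δ hδ hne''

/-! ## §4 THE SUPERCUSPIDAL LABEL, read off the coordinate class; two DISTINCT members carry DIFFERENT labels -/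

/-- **The label is the class**: for a cotangent `Kc`-trivial `P` (so that law `localIsotypyFin` applies and `P` has an irreducible admissible finite component,
★ `exists_irreducible_admissible_hasFinComponent_of_isCot`), «some D6-constituent of `P` at `v` is supercuspidal» iff «`clFin (cl P) v` is supercuspidal»
(every constituent IS that class; a constituent EXISTS, ★ `exists_comap_isConstituentOf_finRepSmooth_comp_cm`). [cite: Flath1979, Thm. 3] [cite: Rogawski1990, §13.1 Prop. 13.1.3 (d)] -/
theorem exists_isSupercuspidal_constituent_iff_of_laws (𝔠 : ClassificationKit L H ι T hT μ) {μω : HeckeCharacter L} {hμu : μω.IsUnitary}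
    {S₀ : Finset (Places L)} (hl : 𝔠.Laws μω hμu S₀)
    (hdef : ∀ τ' : L →+* ℂ, InfinitePlace.mk τ' ≠ InfinitePlace.mk ι → (H.map τ').PosDef) (h2 : 2 ≤ Module.finrank ℚ ↥(maximalRealSubfield L))
    (P : DiscreteAutomorphicRep (Gp L H) μ) (hP : IsCot L H ι T hT μ P) (hKc : KcTrivial L H ι T hT μ P) (v : Places L) :
    (∃ c : IrrClass ((cmDatum L 3 H).Local v),
      (IrrClass.comap (localPiEquiv L (IsCMField.complexConj L) 3 H v) c).IsConstituentOf
          (P.finRep.smoothPart.toRepresentation.comp (inclPlace (↥(maximalRealSubfield L)) L (IsCMField.complexConj L) 3 H v)) ∧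
        c.IsSupercuspidal) ↔ (𝔠.clFin (𝔠.cl P) v).IsSupercuspidal := by
  constructor
  · rintro ⟨c, hc, hsc⟩
    rwa [hl.localIsotypyFin P hP hKc v c hc] at hsc
  · intro h
    obtain ⟨W, _, _, σ, hirrσ, hadm, hPσ⟩ := F0P3AutomorphicFlathAdmissibleOfCot.exists_irreducible_admissible_hasFinComponent_of_isCot ι T hT hdef h2 P hP
    obtain ⟨c, hc⟩ := F0P3FinRepConstituentsExist.exists_comap_isConstituentOf_finRepSmooth_comp_cm P hirrσ hadm.isSmooth hPσ v
    exact ⟨c, hc, by rw [hl.localIsotypyFin P hP hKc v c hc]; exact h⟩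

/-- **Two DISTINCT members of ONE local packet of a ξ-local family carry DIFFERENT supercuspidal labels** (★ D6 `IsXiLocalFamily`): at a SPLIT `v` the packet is
the singleton `cmSplitPacket` (★ `cmSplitPacket_πs = none`), so there are no two distinct members; at a NON-SPLIT `v` the packet is `⟨πⁿ, s⟩` with `πⁿ`
in `JH(i_G(χ_ξ))` — NOT supercuspidal by ★ NE `stubSupercuspidalNeConstituent_holds` — and the optional `πˢ` SUPERCUSPIDAL by the D6 clause, so of two distinct
members exactly one is supercuspidal. [cite: Rogawski1990, §13.1 Prop. 13.1.3 (d) p. 199; §12.2 p. 174; §13.3 p. 201] -/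
theorem not_isSupercuspidal_iff_of_ne_of_isXiLocalFamily {μω : HeckeCharacter L} {hμu : μω.IsUnitary} (ξ : OneDimAutRepH L)
    {hH : (H.map (cmConjRingHom L))ᵀ = H} {hHd : IsUnit H.det} (Pv : ∀ v : Places L, CMLocalAPacket L H v)
    (hfam : ξ.IsXiLocalFamily hH hHd μω hμu Pv)
    (v : Places L) {x y : IrrClass ((cmDatum L 3 H).Local v)} (hx : x ∈ (Pv v).members) (hy : y ∈ (Pv v).members) (hxy : x ≠ y) :
    ¬ (x.IsSupercuspidal ↔ y.IsSupercuspidal) := by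
  by_cases hs : ∃ w : PlacesOver L v, IsCMField.complexConj L • w.1 ≠ w.1
  · -- SPLIT: the packet is a singleton
    have hPv := hfam.1 v hs
    have hnone : (Pv v).πs = none := by rw [hPv]; exact cmSplitPacket_πs L H _ _ v _ _ _ _ _ _ _ _
    rw [LocalAPacket.members_of_πs_eq_none _ hnone, Set.mem_singleton_iff] at hx hy
    exact absurd (hx.trans hy.symm) hxy
  · -- NON-SPLIT: `⟨πⁿ, s⟩`, `πⁿ` not supercuspidal (★ NE), `πˢ` supercuspidal (D6)
    push Not at hs
    obtain ⟨T₀, a, ha, h, x₀, s, hPv, hx₀, hsc⟩ := hfam.2 v hs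
    have hπn : ¬ (Pv v).πn.IsSupercuspidal := by
      intro hn
      have hne := F0P2oSupercuspidalNeConstituent.stubSupercuspidalNeConstituent_holds L H v hs T₀ a ha h _ x₀ hx₀ (Pv v).πn hn
      rw [hPv] at hne
      exact hne rfl
    have hπs : ∀ c, (Pv v).πs = some c → c.IsSupercuspidal := by
      intro c hc'
      rw [hPv] at hc'
      exact hsc c hc'
    rcases (LocalAPacket.mem_members_iff _ _).1 hx with hx' | hx' <;> rcases (LocalAPacket.mem_members_iff _ _).1 hy with hy' | hy'
    · exact absurd (hx'.trans hy'.symm) hxy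
    · rw [hx']; exact fun hiff => hπn (hiff.2 (hπs y hy'))
    · rw [hy']; exact fun hiff => hπn (hiff.1 (hπs x hx'))
    · exact absurd (Option.some_injective _ (hx'.symm.trans hy')) hxy

/-! ## §5 THE RELATIVE PARITY at one frame: two kits (two automorphic measures), ONE `ξ` -/

omit [(Gp L H).IsAutomorphicMeasure μ] in
/-- **Abstract bookkeeping**: if two labels `A`, `B` are read off classes `f`, `f′` through one predicate `SC`, distinct classes carry different labels, and the classes
agree off `S`, then `{v | ¬ (A v ↔ B v)}` is the finite set `{v ∈ S | f v ≠ f′ v}`; so an even count of the latter is an even `ncard` of the former. [folklore] -/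
theorem even_ncard_setOf_not_iff {α : Type*} {C : α → Type*} (S : Finset α) (f f' : ∀ a, C a) (A B : α → Prop) (SC : ∀ a, C a → Prop)
    (hA : ∀ a, A a ↔ SC a (f a)) (hB : ∀ a, B a ↔ SC a (f' a)) (hdiff : ∀ a, f a ≠ f' a → ¬ (SC a (f a) ↔ SC a (f' a)))
    (hoff : ∀ a, a ∉ S → f a = f' a) (heven : Even (S.filter fun a => f a ≠ f' a).card) :
    Even {a | ¬ (A a ↔ B a)}.ncard := by
  classical
  have hset : {a | ¬ (A a ↔ B a)} = ↑(S.filter fun a => f a ≠ f' a) := by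
    ext a
    rw [Set.mem_setOf_eq, Finset.coe_filter, Set.mem_setOf_eq, hA a, hB a]
    by_cases heq : f a = f' a
    · rw [heq]; simp
    · have ha : a ∈ S := by by_contra ha; exact heq (hoff a ha)
      exact ⟨fun _ => ⟨ha, heq⟩, fun _ => hdiff a heq⟩
  rw [hset, Set.ncard_coe_finset]
  exact heven

omit [(Gp L H).IsAutomorphicMeasure μ] in
set_option synthInstance.maxHeartbeats 400000 in
set_option maxHeartbeats 1000000 in
-- ONE assembly theorem over the REL♯ binder zoo (`IsHolCotangentAt`∕`smoothPart` statements elaborate slowly; precedent ★ `F0P2rCuspDictHolds`, LEAD rule: scoped)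
/-- **REL♯ FROM THE LAWS AT ONE FRAME** — for two PINNED kits `𝔠` (on `μA`) and `𝔠′` (on `μA′`) with the laws and a COMMON ξ-side (`hξside`: `N`, `c = sgnG`, `sgnInf`,
`packInf`, `packFin` — the E0 seam of the census, a HYPOTHESIS discharged by `rfl` at a kit family whose ξ-side does not read the measure), two cotangent `P`, `P′`
lying in ONE ξ-local family have supercuspidal labels differing at an EVEN number of finite places.  Proof: §1 twice at the COMMON level `S = S_P ∪ S_P′`; the
engine's `ξ_P = ξ = ξ_P′` (★ `memXiFamily_rigid_cm` under ★ `exists_irreducible_admissible_hasFinComponent_of_isCot`); §3 `clInf = [J^δ]`, `δ = sgnInf ξ = δ′` ⇒ equal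
`ι`-coefficients; §2 ⇒ the coordinate classes differ at an even number of `v ∈ S`; §4 ⇒ «labels differ» = «classes differ» (members of ONE packet), and off `S` both
classes are `πⁿ`. [cite: Rogawski1990, §14.6 Thm. 14.6.4 pp. 238–239; §13.1 Prop. 13.1.3 (d); Prop. 15.2.1 p. 244] -/
theorem relSharp_of_laws
    (hdef : ∀ τ' : L →+* ℂ, InfinitePlace.mk τ' ≠ InfinitePlace.mk ι → (H.map τ').PosDef) (h2 : 2 ≤ Module.finrank ℚ ↥(maximalRealSubfield L))
    (μA : Measure (Gp L H).automorphicQuotient) [(Gp L H).IsAutomorphicMeasure μA]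
    (μA' : Measure (Gp L H).automorphicQuotient) [(Gp L H).IsAutomorphicMeasure μA']
    (𝔠 : ClassificationKit L H ι T hT μA) (𝔠' : ClassificationKit L H ι T hT μA') (hpin : 𝔠.IsPinned) (hpin' : 𝔠'.IsPinned)
    {μω : HeckeCharacter L} {hμu : μω.IsUnitary}
    (hμω : ∀ x : Literature.NumberTheory.GaloisRepresentations.ideleGroup ↥(maximalRealSubfield L),
      μω (AdeleRing.ideleBaseChange (↥(maximalRealSubfield L)) L x) = quadraticHeckeCharCM L x)
    {S₀ S₀' : Finset (Places L)} (hl : 𝔠.Laws μω hμu S₀) (hl' : 𝔠'.Laws μω hμu S₀')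
    (hξside : ∀ ξ : OneDimAutRepH L, 𝔠.N ξ = 𝔠'.N ξ ∧ 𝔠.sgnG ξ = 𝔠'.sgnG ξ ∧ 𝔠.sgnInf ξ = 𝔠'.sgnInf ξ ∧ 𝔠.packInf ξ = 𝔠'.packInf ξ ∧ 𝔠.packFin ξ = 𝔠'.packFin ξ)
    (P : DiscreteAutomorphicRep (Gp L H) μA) (P' : DiscreteAutomorphicRep (Gp L H) μA')
    (hP : IsCot L H ι T hT μA P) (hP' : IsCot L H ι T hT μA' P') (ξ : OneDimAutRepH L)
    (hmem : MemXiFamily P (transpose_map_cmConjRingHom_eq_of_frame L ι H T hT) (isUnit_det_of_frame L ι H T hT) μω hμu ξ)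
    (hmem' : MemXiFamily P' (transpose_map_cmConjRingHom_eq_of_frame L ι H T hT) (isUnit_det_of_frame L ι H T hT) μω hμu ξ) :
    Even ({v : Places L | ¬ ((∃ c : IrrClass ((cmDatum L 3 H).Local v),
        (IrrClass.comap (localPiEquiv L (IsCMField.complexConj L) 3 H v) c).IsConstituentOf
            (P.finRep.smoothPart.toRepresentation.comp (inclPlace (↥(maximalRealSubfield L)) L (IsCMField.complexConj L) 3 H v)) ∧
          c.IsSupercuspidal) ↔
      (∃ c : IrrClass ((cmDatum L 3 H).Local v),
        (IrrClass.comap (localPiEquiv L (IsCMField.complexConj L) 3 H v) c).IsConstituentOf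
            (P'.finRep.smoothPart.toRepresentation.comp (inclPlace (↥(maximalRealSubfield L)) L (IsCMField.complexConj L) 3 H v)) ∧
          c.IsSupercuspidal))}.ncard) := by
  -- `Kc`-triviality of the two cotangent `P`'s (★)
  have hKc : KcTrivial L H ι T hT μA P := F0P3CompactTrivOfRecord.cmCompactFactor_rightRegular_eq_self_of_isHolOrAntihol L ι H T hT P hP
  have hKc' : KcTrivial L H ι T hT μA' P' := F0P3CompactTrivOfRecord.cmCompactFactor_rightRegular_eq_self_of_isHolOrAntihol L ι H T hT P' hP'
  -- §1 twice
  obtain ⟨ξ₁, S₁, hcore₁⟩ := core_of_laws 𝔠 hpin hl hdef h2 P hP hKc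
  obtain ⟨ξ₂, S₂, hcore₂⟩ := core_of_laws 𝔠' hpin' hl' hdef h2 P' hP' hKc'
  -- E3: the engine's `ξ_P`, `ξ_P′` ARE the given `ξ` (rigidity under an irreducible admissible finite component)
  obtain ⟨W, _, _, σ, hirrσ, hadm, hPσ⟩ := F0P3AutomorphicFlathAdmissibleOfCot.exists_irreducible_admissible_hasFinComponent_of_isCot ι T hT hdef h2 P hP
  obtain ⟨W', _, _, σ', hirrσ', hadm', hPσ'⟩ := F0P3AutomorphicFlathAdmissibleOfCot.exists_irreducible_admissible_hasFinComponent_of_isCot ι T hT hdef h2 P' hP'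
  have hξ₁ : ξ₁ = ξ := F0P3XiRigid.memXiFamily_rigid_cm L ι H T hT hdef h2 μA μω hμu hμω P W σ hirrσ hadm.isSmooth hPσ ξ₁ ξ
    (hcore₁ S₁ le_rfl).2.2.2.2.2.2 hmem
  have hξ₂ : ξ₂ = ξ := F0P3XiRigid.memXiFamily_rigid_cm L ι H T hT hdef h2 μA' μω hμu hμω P' W' σ' hirrσ' hadm'.isSmooth hPσ' ξ₂ ξ
    (hcore₂ S₂ le_rfl).2.2.2.2.2.2 hmem'
  rw [hξ₁] at hcore₁
  rw [hξ₂] at hcore₂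
  obtain ⟨hE₁, hc₁, hIm₁, hall₁, hoff₁, hfam₁, -⟩ := hcore₁ (S₁ ∪ S₂) Finset.subset_union_left
  obtain ⟨hE₂, -, hIm₂, hall₂, hoff₂, -, -⟩ := hcore₂ (S₁ ∪ S₂) Finset.subset_union_right
  obtain ⟨-, hsg, hsi, hpI, hpF⟩ := hξside ξ
  have hpF' : ∀ v, 𝔠'.packFin ξ v = 𝔠.packFin ξ v := fun v => by rw [hpF]
  -- E4: equal archimedean coordinates
  obtain ⟨δ, hδ, hcl₁, hδ₁⟩ := clInf_eq_archDegOneClass_of_laws 𝔠 hl hdef h2 P hP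
  obtain ⟨δ', hδ', hcl₂, hδ₂⟩ := clInf_eq_archDegOneClass_of_laws 𝔠' hl' hdef h2 P' hP'
  have hδδ : δ = δ' := by rw [hδ₁ ξ hIm₁, hδ₂ ξ hIm₂, hsi]
  subst hδδ
  have hιcls : 𝔠.clInf (𝔠.cl P) = 𝔠'.clInf (𝔠'.cl P') := hcl₁.trans hcl₂.symm
  -- §2: the finite coordinate classes differ at an EVEN number of `v ∈ S`
  have hsign₁ := sign_eq_sgnG_of_expansion_eq_one 𝔠 ξ (S₁ ∪ S₂) (𝔠.coordS (S₁ ∪ S₂) (𝔠.cl P)) hIm₁ (fun v => hall₁ v.1) hc₁ hE₁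
  have hsign₂ := sign_eq_sgnG_of_expansion_eq_one 𝔠' ξ (S₁ ∪ S₂) (𝔠'.coordS (S₁ ∪ S₂) (𝔠'.cl P')) hIm₂ (fun v => hall₂ v.1)
    (by rw [← hsg]; exact hc₁) hE₂
  simp only [F0P3InnerFormClassificationV6.ClassificationKit.coordS] at hsign₁ hsign₂
  rw [← hsg, ← hpI] at hsign₂
  simp only [hpF'] at hsign₂
  have hιeq : memberCoeff (𝔠.packInf ξ) (-1) (𝔠.clInf (𝔠.cl P)) = memberCoeff (𝔠.packInf ξ) (-1) (𝔠'.clInf (𝔠'.cl P')) := by rw [hιcls]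
  have hIm₂' : 𝔠'.clInf (𝔠'.cl P') ∈ (𝔠.packInf ξ).members := by rw [hpI]; exact hIm₂
  have hall₂' : ∀ v, 𝔠'.clFin (𝔠'.cl P') v ∈ (𝔠.packFin ξ v).members := fun v => by rw [← hpF' v]; exact hall₂ v
  have heven := even_card_filter_ne_of_sign_eq (𝔠.packInf ξ) (𝔠.packFin ξ) (S₁ ∪ S₂) (𝔠.clInf (𝔠.cl P)) (𝔠'.clInf (𝔠'.cl P'))
    (fun v => 𝔠.clFin (𝔠.cl P) v) (fun v => 𝔠'.clFin (𝔠'.cl P') v) hIm₂' (fun v _ => hall₁ v) (fun v _ => hall₂' v) (𝔠.sgnG ξ) hsign₁ hsign₂ hιeq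
  -- §4: «labels differ» = «classes differ», place by place; off `S` both classes are `πⁿ`
  exact even_ncard_setOf_not_iff (S₁ ∪ S₂) (fun v => 𝔠.clFin (𝔠.cl P) v) (fun v => 𝔠'.clFin (𝔠'.cl P') v) _ _
    (fun v (x : IrrClass ((cmDatum L 3 H).Local v)) => x.IsSupercuspidal)
    (fun v => exists_isSupercuspidal_constituent_iff_of_laws 𝔠 hl hdef h2 P hP hKc v)
    (fun v => exists_isSupercuspidal_constituent_iff_of_laws 𝔠' hl' hdef h2 P' hP' hKc' v)
    (fun v hne => not_isSupercuspidal_iff_of_ne_of_isXiLocalFamily ξ (𝔠.packFin ξ) hfam₁ v (hall₁ v) (hall₂' v) hne)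
    (fun v hv => show 𝔠.clFin (𝔠.cl P) v = 𝔠'.clFin (𝔠'.cl P') v by rw [hoff₁ v hv, hoff₂ v hv, hpF' v]) heven

end Core

/-! ## §6 THE HEAD over a NAMED PINNED KIT FAMILY WITH THE LAWS: REL♯ (`StubRelSharpParity` body, `CuspLabel` unfolded) -/

set_option synthInstance.maxHeartbeats 400000 in
set_option maxHeartbeats 400000 in
-- the head's statement is the REL♯ text (precedent: the Lines def `StubRelSharpParity` itself elaborates under a scoped budget)
/-- **REL♯ «(C4)» ⟸ T5** — for a kit FAMILY `𝔎` (★ `KitFamily`) that is PINNED and carries the LAWS at every letters' frame, and whose ξ-side (`N`, `sgnG`, `sgnInf`,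
`packInf`, `packFin`) does not depend on the automorphic measure (`hξside`, the E0 seam — `rfl` ×5 at a family like the kit family of record whose ξ-side is built from
`μω` only), the booked statement #162 `StubRelSharpParity` holds with `CuspLabel` unfolded: two (hol ∨ antihol)-cotangent discrete `P`, `P′` of `U(H)` lying in ONE ξ-local
family (★ D6 `MemXiFamily`, Rogawski's `μω`) have supercuspidal labels differing at an EVEN number of finite places of `L⁺`.  At the closer's `𝔎₀` this is REL♯ modulo
the closer's own stub set (like ★ `aPacketMembersGuarded_of_T5` ∕ #75) — the book-closing token is the P3 desk's one-liner junction.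
[cite: Rogawski1990, §14.6 Thm. 14.6.4 pp. 236–239; §13.1 Prop. 13.1.3 (d) p. 199; §15.2 Prop. 15.2.1 p. 244; §15.3 ¶1 p. 244] -/
theorem relSharpGuarded_of_T5 (𝔎 : KitFamily) (hpin : KitFamily.IsPinned 𝔎) (hlaws : 𝔎.Laws)
    (hξside : ∀ (L : Type) [Field L] [NumberField L] [IsCMField L] (ι : L →+* ℂ) (H : Matrix (Fin 3) (Fin 3) L) (T : GL (Fin 3) ℂ)
      (hT : (T : Matrix (Fin 3) (Fin 3) ℂ)ᴴ * H.map ι * (T : Matrix (Fin 3) (Fin 3) ℂ) = Literature.Geometry.ComplexHyperbolic.BallModel.J)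
      (hdef : ∀ τ' : L →+* ℂ, InfinitePlace.mk τ' ≠ InfinitePlace.mk ι → (H.map τ').PosDef)
      (h2 : 2 ≤ Module.finrank ℚ ↥(maximalRealSubfield L))
      (μA : Measure (Gp L H).automorphicQuotient) [(Gp L H).IsAutomorphicMeasure μA]
      (μA' : Measure (Gp L H).automorphicQuotient) [(Gp L H).IsAutomorphicMeasure μA']
      (μω : HeckeCharacter L) (hμu : μω.IsUnitary)
      (hμω : ∀ x : Literature.NumberTheory.GaloisRepresentations.ideleGroup ↥(maximalRealSubfield L),
        μω (AdeleRing.ideleBaseChange (↥(maximalRealSubfield L)) L x) = quadraticHeckeCharCM L x) (ξ : OneDimAutRepH L),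
      (𝔎 L ι H T hT hdef h2 μA μω hμu hμω).N ξ = (𝔎 L ι H T hT hdef h2 μA' μω hμu hμω).N ξ ∧
      (𝔎 L ι H T hT hdef h2 μA μω hμu hμω).sgnG ξ = (𝔎 L ι H T hT hdef h2 μA' μω hμu hμω).sgnG ξ ∧
      (𝔎 L ι H T hT hdef h2 μA μω hμu hμω).sgnInf ξ = (𝔎 L ι H T hT hdef h2 μA' μω hμu hμω).sgnInf ξ ∧
      (𝔎 L ι H T hT hdef h2 μA μω hμu hμω).packInf ξ = (𝔎 L ι H T hT hdef h2 μA' μω hμu hμω).packInf ξ ∧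
      (𝔎 L ι H T hT hdef h2 μA μω hμu hμω).packFin ξ = (𝔎 L ι H T hT hdef h2 μA' μω hμu hμω).packFin ξ) :
    ∀ (L : Type) [Field L] [NumberField L] [IsCMField L] (ι : L →+* ℂ) (H : Matrix (Fin 3) (Fin 3) L) (T : GL (Fin 3) ℂ)
      (hT : (T : Matrix (Fin 3) (Fin 3) ℂ)ᴴ * H.map ι * (T : Matrix (Fin 3) (Fin 3) ℂ) = Literature.Geometry.ComplexHyperbolic.BallModel.J),
      (∀ τ' : L →+* ℂ, InfinitePlace.mk τ' ≠ InfinitePlace.mk ι → (H.map τ').PosDef) → 2 ≤ Module.finrank ℚ ↥(maximalRealSubfield L) →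
        ∀ (μA : Measure (adelicGroupData (↥(maximalRealSubfield L)) L (IsCMField.complexConj L) 3 H).automorphicQuotient)
          [(adelicGroupData (↥(maximalRealSubfield L)) L (IsCMField.complexConj L) 3 H).IsAutomorphicMeasure μA]
          (μA' : Measure (adelicGroupData (↥(maximalRealSubfield L)) L (IsCMField.complexConj L) 3 H).automorphicQuotient)
          [(adelicGroupData (↥(maximalRealSubfield L)) L (IsCMField.complexConj L) 3 H).IsAutomorphicMeasure μA']
          (P : DiscreteAutomorphicRep (adelicGroupData (↥(maximalRealSubfield L)) L (IsCMField.complexConj L) 3 H) μA)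
          (P' : DiscreteAutomorphicRep (adelicGroupData (↥(maximalRealSubfield L)) L (IsCMField.complexConj L) 3 H) μA'),
          (P.IsHolCotangentAt (cmArchSection L ι H T hT) (cmCompactFactor L ι H T hT) ∨ P.IsAntiholCotangentAt (cmArchSection L ι H T hT) (cmCompactFactor L ι H T hT)) →
          (P'.IsHolCotangentAt (cmArchSection L ι H T hT) (cmCompactFactor L ι H T hT) ∨ P'.IsAntiholCotangentAt (cmArchSection L ι H T hT) (cmCompactFactor L ι H T hT)) →
          ∀ (μω : HeckeCharacter L) (hμu : μω.IsUnitary),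
            (∀ x : Literature.NumberTheory.GaloisRepresentations.ideleGroup ↥(maximalRealSubfield L),
              μω (AdeleRing.ideleBaseChange (↥(maximalRealSubfield L)) L x) = quadraticHeckeCharCM L x) →
          ∀ (ξ : OneDimAutRepH L),
            MemXiFamily P (transpose_map_cmConjRingHom_eq_of_frame L ι H T hT) (isUnit_det_of_frame L ι H T hT) μω hμu ξ →
            MemXiFamily P' (transpose_map_cmConjRingHom_eq_of_frame L ι H T hT) (isUnit_det_of_frame L ι H T hT) μω hμu ξ →
              Even ({v : HeightOneSpectrum (𝓞 ↥(maximalRealSubfield L)) | ¬ ((∃ c : IrrClass ((cmDatum L 3 H).Local v),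
                  (IrrClass.comap (localPiEquiv L (IsCMField.complexConj L) 3 H v) c).IsConstituentOf
                      (P.finRep.smoothPart.toRepresentation.comp (inclPlace (↥(maximalRealSubfield L)) L (IsCMField.complexConj L) 3 H v)) ∧
                    c.IsSupercuspidal) ↔
                (∃ c : IrrClass ((cmDatum L 3 H).Local v),
                  (IrrClass.comap (localPiEquiv L (IsCMField.complexConj L) 3 H v) c).IsConstituentOf
                      (P'.finRep.smoothPart.toRepresentation.comp (inclPlace (↥(maximalRealSubfield L)) L (IsCMField.complexConj L) 3 H v)) ∧
                    c.IsSupercuspidal))}.ncard) := by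
  intro L _ _ _ ι H T hT hdef h2 μA _ μA' _ P P' hP hP' μω hμu hμω ξ hmem hmem'
  obtain ⟨S₀, hl⟩ := hlaws L ι H T hT hdef h2 μA μω hμu hμω
  obtain ⟨S₀', hl'⟩ := hlaws L ι H T hT hdef h2 μA' μω hμu hμω
  exact relSharp_of_laws hdef h2 μA μA' _ _ (hpin L ι H T hT hdef h2 μA μω hμu hμω) (hpin L ι H T hT hdef h2 μA' μω hμu hμω) hμω hl hl'
    (hξside L ι H T hT hdef h2 μA μA' μω hμu hμω) P P' hP hP' ξ hmem hmem'

/-! ## §7 (ED. 2) ONE MEASURE: the seam-free export -/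

set_option synthInstance.maxHeartbeats 400000 in
set_option maxHeartbeats 400000 in
-- the head's statement is the REL♯ text at ONE automorphic measure (same scoped budget as §6)
/-- **REL♯ AT ONE AUTOMORPHIC MEASURE — NO SEAM** (ED. 2): when `P` and `P′` are discrete for the SAME automorphic measure `μA`, the two kits of §5 coincide and the
E0 seam `hξside` is `rfl` ×5 for EVERY kit family; so a PINNED kit family with the LAWS gives the one-measure REL♯ outright.  (At the closer's family of record the
ξ-side `sgnG ∕ packInf ∕ packFin` is read off the rung-0 CHOICE at `(frame, μ)`, so the two-measure seam of §6 is NOT definitional there; this corollary is the form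
whose junction at `𝔎₀` is hypothesis-free — census `F0/P2/p02/g9/CENSUS-F2-RelParityOfT5.F0P2p02g9.md` §E0.) [cite: Rogawski1990, §14.6 Thm. 14.6.4 pp. 236–239; §13.1 Prop. 13.1.3 (d); §15.2 Prop. 15.2.1] -/
theorem relSharpGuardedOneMeasure_of_T5 (𝔎 : KitFamily) (hpin : KitFamily.IsPinned 𝔎) (hlaws : 𝔎.Laws) :
    ∀ (L : Type) [Field L] [NumberField L] [IsCMField L] (ι : L →+* ℂ) (H : Matrix (Fin 3) (Fin 3) L) (T : GL (Fin 3) ℂ)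
      (hT : (T : Matrix (Fin 3) (Fin 3) ℂ)ᴴ * H.map ι * (T : Matrix (Fin 3) (Fin 3) ℂ) = Literature.Geometry.ComplexHyperbolic.BallModel.J),
      (∀ τ' : L →+* ℂ, InfinitePlace.mk τ' ≠ InfinitePlace.mk ι → (H.map τ').PosDef) → 2 ≤ Module.finrank ℚ ↥(maximalRealSubfield L) →
        ∀ (μA : Measure (adelicGroupData (↥(maximalRealSubfield L)) L (IsCMField.complexConj L) 3 H).automorphicQuotient)
          [(adelicGroupData (↥(maximalRealSubfield L)) L (IsCMField.complexConj L) 3 H).IsAutomorphicMeasure μA]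
          (P P' : DiscreteAutomorphicRep (adelicGroupData (↥(maximalRealSubfield L)) L (IsCMField.complexConj L) 3 H) μA),
          (P.IsHolCotangentAt (cmArchSection L ι H T hT) (cmCompactFactor L ι H T hT) ∨ P.IsAntiholCotangentAt (cmArchSection L ι H T hT) (cmCompactFactor L ι H T hT)) →
          (P'.IsHolCotangentAt (cmArchSection L ι H T hT) (cmCompactFactor L ι H T hT) ∨ P'.IsAntiholCotangentAt (cmArchSection L ι H T hT) (cmCompactFactor L ι H T hT)) →
          ∀ (μω : HeckeCharacter L) (hμu : μω.IsUnitary),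
            (∀ x : Literature.NumberTheory.GaloisRepresentations.ideleGroup ↥(maximalRealSubfield L),
              μω (AdeleRing.ideleBaseChange (↥(maximalRealSubfield L)) L x) = quadraticHeckeCharCM L x) →
          ∀ (ξ : OneDimAutRepH L),
            MemXiFamily P (transpose_map_cmConjRingHom_eq_of_frame L ι H T hT) (isUnit_det_of_frame L ι H T hT) μω hμu ξ →
            MemXiFamily P' (transpose_map_cmConjRingHom_eq_of_frame L ι H T hT) (isUnit_det_of_frame L ι H T hT) μω hμu ξ →
              Even ({v : HeightOneSpectrum (𝓞 ↥(maximalRealSubfield L)) | ¬ ((∃ c : IrrClass ((cmDatum L 3 H).Local v),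
                  (IrrClass.comap (localPiEquiv L (IsCMField.complexConj L) 3 H v) c).IsConstituentOf
                      (P.finRep.smoothPart.toRepresentation.comp (inclPlace (↥(maximalRealSubfield L)) L (IsCMField.complexConj L) 3 H v)) ∧
                    c.IsSupercuspidal) ↔
                (∃ c : IrrClass ((cmDatum L 3 H).Local v),
                  (IrrClass.comap (localPiEquiv L (IsCMField.complexConj L) 3 H v) c).IsConstituentOf
                      (P'.finRep.smoothPart.toRepresentation.comp (inclPlace (↥(maximalRealSubfield L)) L (IsCMField.complexConj L) 3 H v)) ∧
                    c.IsSupercuspidal))}.ncard) := by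
  intro L _ _ _ ι H T hT hdef h2 μA _ P P' hP hP' μω hμu hμω ξ hmem hmem'
  obtain ⟨S₀, hl⟩ := hlaws L ι H T hT hdef h2 μA μω hμu hμω
  exact relSharp_of_laws hdef h2 μA μA _ _ (hpin L ι H T hT hdef h2 μA μω hμu hμω) (hpin L ι H T hT hdef h2 μA μω hμu hμω) hμω hl hl
    (fun _ => ⟨rfl, rfl, rfl, rfl, rfl⟩) P P' hP hP' ξ hmem hmem'

end Summit.HodgeConjecture.HodgeConjecture.Cruxes.H413.F0P3RelParityOfT5

end
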